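import Mathlib
import Summits.ValiantsHypothesis.ValiantsHypothesis.Theorems.NewtonUnitEquationsDissociatedUniformTotalsLaw
import Summits.ValiantsHypothesis.ValiantsHypothesis.Theorems.NewtonUnitEquationsDissociatedUniformTotalsLawUnimodal
import Summits.ValiantsHypothesis.ValiantsHypothesis.Theorems.NewtonUnitEquationsDissociatedUniformTotalsLawHexagon
import Summits.ValiantsHypothesis.ValiantsHypothesis.Theorems.NewtonUnitEquationsDissociatedUniformTotalsLawHexagonCount
import Summits.ValiantsHypothesis.ValiantsHypothesis.Theorems.NewtonUnitEquationsDissociatedUniformTotalsLawHodograph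
import Summits.ValiantsHypothesis.ValiantsHypothesis.Theorems.NewtonUnitEquationsDissociatedUniformTotalsLawHodographFamilies
import HarnessLib

/-!
# Crux `NewtonUnitEquations.DissociatedUniform` (stmt-ValiantsHypothesis-5905), `n = 3` totals law of model (Q**):
# relabelling invariance, winding relabellings, and the CROSSING-NUMBER form of the hodograph law

Three additions to the hodograph-convex totals law (`…TotalsLawHodographFamilies.totalVert_le_six_mul_sq_add`: `T ≤ 6q² + 6Z` when the three
edge-vector curves are convexly ordered):

* **Relabelling invariance** (any finite abelian groups): `totalVert (a ∘ φ) (b ∘ φ) (c ∘ φ) = totalVert a b c` for an additive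
  isomorphism `φ : H ≃+ G` (classes are permuted, `classPts_comp_addEquiv`), and `totalVert (a ∘ (· + t)) b c = totalVert a b c` (a label
  translation on ONE curve permutes the classes, `totalVert_shift₁/₂/₃`).  So the totals law is a statement about curves up to the affine
  relabelling group of `G`, acting diagonally by automorphisms and independently by translations.
* **Winding relabellings**: consequently `T ≤ 6q² + 6Z` whenever, for some unit `u` of `ℤ/q`, the three reparametrised curves `k ↦ a (u k)`,
  `k ↦ b (u k)`, `k ↦ c (u k)` have convexly ordered hodographs (`totalVert_le_of_unit_relabelling`) — e.g. smooth convex curves all traversed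
  with the same winding number `m`, `gcd(m, q) = 1` (the census "three-arc / multiplier" families of NOTES-d1g3 §3 with a common multiplier).
* **Crossing-number form**: `FewCrossings v K` := every affine functional changes sign strictly at most `K` times along the cyclic sequence
  `v`; `ConvexlyOrdered v → FewCrossings v 2`; `flipsC_le_of_fewCrossings`: `N_c ≤ K·q² + 2Z`; **`totalVert_le_of_fewCrossings`**:
  `T ≤ (K_a + K_b + K_c)·q² + 6Z` — the law degrades linearly in the oscillation of the hodographs (for a convex polygon with alternating edge
  lengths `K ≍ q` and the bound is void, matching this seat's census: fold counts `5.5, 7.0, 8.1 q²` at `q = 7, 11, 13`).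

`TotalsLawThree C` (arbitrary labellings) remains OPEN; VP ≠ VNP is not touched.
[folklore: reindexing a sum over a group by an automorphism or a translation]
-/

set_option linter.dupNamespace false -- `ValiantsHypothesis.ValiantsHypothesis` (summit = problem) in every name

open scoped BigOperators Pointwise

namespace Summit.ValiantsHypothesis.ValiantsHypothesis.Theorems.NewtonUnitEquationsDissociatedUniform

namespace TotalsLaw

open Matrix

/-! ### Relabelling invariance -/

section Relabel

variable {G H : Type*} [AddCommGroup G] [Fintype G] [AddCommGroup H] [Fintype H]

omit [Fintype G] [Fintype H] in
/-- Reparametrising all three curves by an additive isomorphism `φ` permutes the classes: `class(a∘φ, b∘φ, c∘φ) s = class(a,b,c) (φ s)`.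
[folklore] -/
theorem classPts_comp_addEquiv (φ : H ≃+ G) (a b c : G → (Fin 2 → ℝ)) (s : H) :
    classPts (a ∘ φ) (b ∘ φ) (c ∘ φ) s = classPts a b c (φ s) := by
  ext p
  simp only [classPts, Set.mem_range, Prod.exists, Function.comp_apply]
  constructor
  · rintro ⟨x, y, rfl⟩
    exact ⟨φ x, φ y, by rw [map_sub, map_sub]⟩
  · rintro ⟨x, y, rfl⟩
    refine ⟨φ.symm x, φ.symm y, ?_⟩
    rw [map_sub, map_sub, AddEquiv.apply_symm_apply, AddEquiv.apply_symm_apply]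

omit [Fintype G] [Fintype H] in
/-- `V_s(a∘φ, b∘φ, c∘φ) = V_{φ s}(a, b, c)`. [folklore] -/
theorem classVert_comp_addEquiv (φ : H ≃+ G) (a b c : G → (Fin 2 → ℝ)) (s : H) :
    classVert (a ∘ φ) (b ∘ φ) (c ∘ φ) s = classVert a b c (φ s) := by
  unfold classVert
  rw [classPts_comp_addEquiv]

/-- **Automorphism invariance of the totals**: `T(a∘φ, b∘φ, c∘φ) = T(a, b, c)`. [folklore] -/
theorem totalVert_comp_addEquiv (φ : H ≃+ G) (a b c : G → (Fin 2 → ℝ)) :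
    totalVert (a ∘ φ) (b ∘ φ) (c ∘ φ) = totalVert a b c := by
  unfold totalVert
  simp_rw [classVert_comp_addEquiv]
  exact Equiv.sum_comp φ.toEquiv (classVert a b c)

omit [Fintype G] in
/-- Translating the labels of the FIRST curve permutes the classes: `class(a(· + t), b, c) s = class(a, b, c) (s + t)`. [folklore] -/
theorem classPts_shift₁ (a b c : G → (Fin 2 → ℝ)) (t s : G) :
    classPts (fun x => a (x + t)) b c s = classPts a b c (s + t) := by
  ext p
  simp only [classPts, Set.mem_range, Prod.exists]
  constructor
  · rintro ⟨x, y, rfl⟩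
    exact ⟨x + t, y, by rw [show s + t - (x + t) - y = s - x - y by abel]⟩
  · rintro ⟨x, y, rfl⟩
    exact ⟨x - t, y, by rw [sub_add_cancel, show s - (x - t) - y = s + t - x - y by abel]⟩

/-- **Translation invariance (first curve)**: `T(a(· + t), b, c) = T(a, b, c)`. [folklore] -/
theorem totalVert_shift₁ (a b c : G → (Fin 2 → ℝ)) (t : G) : totalVert (fun x => a (x + t)) b c = totalVert a b c := by
  unfold totalVert classVert
  simp_rw [classPts_shift₁]
  exact Equiv.sum_comp (Equiv.addRight t) fun s => ((convexHull ℝ (classPts a b c s)).extremePoints ℝ).ncard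

/-- Translation invariance (second curve). [folklore] -/
theorem totalVert_shift₂ (a b c : G → (Fin 2 → ℝ)) (t : G) : totalVert a (fun y => b (y + t)) c = totalVert a b c := by
  rw [totalVert_swap, totalVert_shift₁, totalVert_swap]

/-- Translation invariance (third curve). [folklore] -/
theorem totalVert_shift₃ (a b c : G → (Fin 2 → ℝ)) (t : G) : totalVert a b (fun z => c (z + t)) = totalVert a b c := by
  rw [← totalVert_rotate c a b, ← totalVert_rotate (fun z => c (z + t)) a b, totalVert_shift₁]

end Relabel

/-! ### Winding relabellings of `ℤ/q` -/

section Winding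

variable {q : ℕ} [NeZero q]

/-- Multiplication by a unit of `ℤ/q` as an additive automorphism. [folklore] -/
def unitMulAddEquiv (u : (ZMod q)ˣ) : ZMod q ≃+ ZMod q where
  toFun x := (u : ZMod q) * x
  invFun x := ((u⁻¹ : (ZMod q)ˣ) : ZMod q) * x
  left_inv x := Units.inv_mul_cancel_left u x
  right_inv x := Units.mul_inv_cancel_left u x
  map_add' _ _ := mul_add _ _ _

omit [NeZero q] in
/-- The action of `unitMulAddEquiv`. [folklore] -/
theorem unitMulAddEquiv_apply (u : (ZMod q)ˣ) (x : ZMod q) : unitMulAddEquiv u x = (u : ZMod q) * x := rfl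

variable (a b c : ZMod q → (Fin 2 → ℝ))

/-- **Winding relabellings.**  If for some unit `u` the reparametrised curves `k ↦ a(u k)`, `k ↦ b(u k)`, `k ↦ c(u k)` have convexly ordered
hodographs, then `T(a,b,c) ≤ 6q² + 6Z'` (`Z'` the collinear count of the reparametrised hodographs). [folklore] -/
theorem totalVert_le_of_unit_relabelling (u : (ZMod q)ˣ)
    (ha : ConvexlyOrdered (edgeVec fun k => a ((u : ZMod q) * k))) (hb : ConvexlyOrdered (edgeVec fun k => b ((u : ZMod q) * k)))
    (hc : ConvexlyOrdered (edgeVec fun k => c ((u : ZMod q) * k))) :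
    totalVert a b c ≤ 6 * q ^ 2 +
      6 * zeroCount (fun k => a ((u : ZMod q) * k)) (fun k => b ((u : ZMod q) * k)) (fun k => c ((u : ZMod q) * k)) := by
  have hinv := totalVert_comp_addEquiv (unitMulAddEquiv u) a b c
  have h := totalVert_le_six_mul_sq_add (fun k => a ((u : ZMod q) * k)) (fun k => b ((u : ZMod q) * k))
    (fun k => c ((u : ZMod q) * k)) ha hb hc
  have e : totalVert (a ∘ (unitMulAddEquiv u)) (b ∘ (unitMulAddEquiv u)) (c ∘ (unitMulAddEquiv u)) =
      totalVert (fun k => a ((u : ZMod q) * k)) (fun k => b ((u : ZMod q) * k)) (fun k => c ((u : ZMod q) * k)) := rfl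
  rw [← hinv, e]
  exact h

end Winding

/-! ### The crossing-number form -/

section Crossings

variable {q : ℕ} [NeZero q]

/-- `v : ℤ/q → ℝ²` has AFFINE CROSSING NUMBER `≤ K`: every affine functional changes sign strictly at most `K` times between cyclically
consecutive labels. (`K = 2` for convexly ordered sequences; `K ≍ q` for a convex polygon's edge vectors with alternating lengths.) -/
def FewCrossings (v : ZMod q → (Fin 2 → ℝ)) (K : ℕ) : Prop :=
  ∀ (w : Fin 2 → ℝ) (t : ℝ), ∑ k : ZMod q, indic ((w ⬝ᵥ v k - t) * (w ⬝ᵥ v (k + 1) - t) < 0) ≤ K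

/-- Convexly ordered sequences have crossing number `≤ 2`. [folklore] -/
theorem ConvexlyOrdered.fewCrossings {v : ZMod q → (Fin 2 → ℝ)} (hv : ConvexlyOrdered v) : FewCrossings v 2 :=
  fun w t => sum_indic_cross_le_two (hv w) t

/-- Weak crossings from strict ones: `#{k : (f k − t)(f(k+1) − t) ≤ 0} ≤ #strict + 2·#{k : f k = t}`. [folklore] -/
theorem sum_indic_mul_nonpos_le_add (f : ZMod q → ℝ) (t : ℝ) :
    ∑ k : ZMod q, indic ((f k - t) * (f (k + 1) - t) ≤ 0) ≤
      ∑ k : ZMod q, indic ((f k - t) * (f (k + 1) - t) < 0) + 2 * ∑ k : ZMod q, indic (f k = t) := by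
  have hsplit : ∀ k : ZMod q, indic ((f k - t) * (f (k + 1) - t) ≤ 0) ≤
      indic ((f k - t) * (f (k + 1) - t) < 0) + indic (f k = t) + indic (f (k + 1) = t) := by
    intro k
    by_cases hk : (f k - t) * (f (k + 1) - t) ≤ 0
    · rw [indic_of_true hk]
      rcases hk.lt_or_eq with hlt | heq
      · rw [indic_of_true hlt]; omega
      · rcases mul_eq_zero.1 heq with h0 | h0
        · rw [indic_of_true (sub_eq_zero.1 h0)]; omega
        · rw [indic_of_true (sub_eq_zero.1 h0 : f (k + 1) = t)]; omega
    · rw [indic_of_false hk]; exact Nat.zero_le _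
  calc ∑ k : ZMod q, indic ((f k - t) * (f (k + 1) - t) ≤ 0)
      ≤ ∑ k : ZMod q, (indic ((f k - t) * (f (k + 1) - t) < 0) + indic (f k = t) + indic (f (k + 1) = t)) :=
        Finset.sum_le_sum fun k _ => hsplit k
    _ = ∑ k : ZMod q, indic ((f k - t) * (f (k + 1) - t) < 0) + ∑ k : ZMod q, indic (f k = t) +
          ∑ k : ZMod q, indic (f (k + 1) = t) := by rw [Finset.sum_add_distrib, Finset.sum_add_distrib]
    _ = _ := by rw [sum_indic_succ_eq (fun k => f k = t)]; ring

variable (a b c : ZMod q → (Fin 2 → ℝ))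

/-- **`N_c ≤ K q² + 2Z`** when the hodograph `Δc` has crossing number `≤ K`. [folklore] -/
theorem flipsC_le_of_fewCrossings {K : ℕ} (hc : FewCrossings (edgeVec c) K) : flipsC a b c ≤ K * q ^ 2 + 2 * zeroCount a b c := by
  have inner : ∀ i j : ZMod q, ∑ k : ZMod q, indic (flipC a b c i j k) ≤ K + 2 * ∑ k : ZMod q, indic (orientT a b c i j k = 0) := by
    intro i j
    set w : Fin 2 → ℝ := ![-(edgeVec b j - edgeVec a i) 1, (edgeVec b j - edgeVec a i) 0] with hw
    set t : ℝ := -cross2 (edgeVec a i) (edgeVec b j) with ht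
    have hO : ∀ k, orientT a b c i j k = w ⬝ᵥ edgeVec c k - t := fun k => orientT_affine₃ a b c i j k
    have h := sum_indic_mul_nonpos_le_add (fun k => w ⬝ᵥ edgeVec c k) t
    have hK := hc w t
    have e1 : ∀ k : ZMod q, indic (flipC a b c i j k) = indic ((w ⬝ᵥ edgeVec c k - t) * (w ⬝ᵥ edgeVec c (k + 1) - t) ≤ 0) := by
      intro k; unfold flipC; rw [hO k, hO (k + 1)]
    have e2 : ∀ k : ZMod q, indic (orientT a b c i j k = 0) = indic (w ⬝ᵥ edgeVec c k = t) := by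
      intro k; rw [hO k, sub_eq_zero]
    simp only [e1, e2]
    omega
  unfold flipsC zeroCount
  calc ∑ i : ZMod q, ∑ j : ZMod q, ∑ k : ZMod q, indic (flipC a b c i j k)
      ≤ ∑ i : ZMod q, ∑ j : ZMod q, (K + 2 * ∑ k : ZMod q, indic (orientT a b c i j k = 0)) :=
        Finset.sum_le_sum fun i _ => Finset.sum_le_sum fun j _ => inner i j
    _ = K * q ^ 2 + 2 * ∑ i : ZMod q, ∑ j : ZMod q, ∑ k : ZMod q, indic (orientT a b c i j k = 0) := by
        simp only [Finset.sum_add_distrib, sum_const_nat, ← Finset.mul_sum]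
        ring

/-- `N_a ≤ K q² + 2Z` when `Δa` has crossing number `≤ K`. [folklore] -/
theorem flipsA_le_of_fewCrossings {K : ℕ} (ha : FewCrossings (edgeVec a) K) : flipsA a b c ≤ K * q ^ 2 + 2 * zeroCount a b c := by
  have inner : ∀ j k : ZMod q, ∑ i : ZMod q, indic (flipA a b c i j k) ≤ K + 2 * ∑ i : ZMod q, indic (orientT a b c i j k = 0) := by
    intro j k
    set w : Fin 2 → ℝ := ![-(edgeVec c k - edgeVec b j) 1, (edgeVec c k - edgeVec b j) 0] with hw
    set t : ℝ := -cross2 (edgeVec b j) (edgeVec c k) with ht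
    have hO : ∀ i, orientT a b c i j k = w ⬝ᵥ edgeVec a i - t := fun i => orientT_affine₁ a b c i j k
    have h := sum_indic_mul_nonpos_le_add (fun i => w ⬝ᵥ edgeVec a i) t
    have hK := ha w t
    have e1 : ∀ i : ZMod q, indic (flipA a b c i j k) = indic ((w ⬝ᵥ edgeVec a i - t) * (w ⬝ᵥ edgeVec a (i + 1) - t) ≤ 0) := by
      intro i; unfold flipA; rw [hO i, hO (i + 1)]
    have e2 : ∀ i : ZMod q, indic (orientT a b c i j k = 0) = indic (w ⬝ᵥ edgeVec a i = t) := by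
      intro i; rw [hO i, sub_eq_zero]
    simp only [e1, e2]
    omega
  unfold flipsA zeroCount
  rw [Finset.sum_comm]
  conv_lhs => arg 2; ext j; rw [Finset.sum_comm]
  rw [Finset.sum_comm (f := fun i j => ∑ k : ZMod q, indic (orientT a b c i j k = 0))]
  conv_rhs => arg 2; arg 2; arg 2; ext j; rw [Finset.sum_comm]
  calc ∑ j : ZMod q, ∑ k : ZMod q, ∑ i : ZMod q, indic (flipA a b c i j k)
      ≤ ∑ j : ZMod q, ∑ k : ZMod q, (K + 2 * ∑ i : ZMod q, indic (orientT a b c i j k = 0)) :=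
        Finset.sum_le_sum fun j _ => Finset.sum_le_sum fun k _ => inner j k
    _ = K * q ^ 2 + 2 * ∑ j : ZMod q, ∑ k : ZMod q, ∑ i : ZMod q, indic (orientT a b c i j k = 0) := by
        simp only [Finset.sum_add_distrib, sum_const_nat, ← Finset.mul_sum]
        ring

/-- `N_b ≤ K q² + 2Z` when `Δb` has crossing number `≤ K`. [folklore] -/
theorem flipsB_le_of_fewCrossings {K : ℕ} (hb : FewCrossings (edgeVec b) K) : flipsB a b c ≤ K * q ^ 2 + 2 * zeroCount a b c := by
  have inner : ∀ i k : ZMod q, ∑ j : ZMod q, indic (flipB a b c i j k) ≤ K + 2 * ∑ j : ZMod q, indic (orientT a b c i j k = 0) := by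
    intro i k
    set w : Fin 2 → ℝ := ![-(edgeVec a i - edgeVec c k) 1, (edgeVec a i - edgeVec c k) 0] with hw
    set t : ℝ := -cross2 (edgeVec c k) (edgeVec a i) with ht
    have hO : ∀ j, orientT a b c i j k = w ⬝ᵥ edgeVec b j - t := fun j => orientT_affine₂ a b c i j k
    have h := sum_indic_mul_nonpos_le_add (fun j => w ⬝ᵥ edgeVec b j) t
    have hK := hb w t
    have e1 : ∀ j : ZMod q, indic (flipB a b c i j k) = indic ((w ⬝ᵥ edgeVec b j - t) * (w ⬝ᵥ edgeVec b (j + 1) - t) ≤ 0) := by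
      intro j; unfold flipB; rw [hO j, hO (j + 1)]
    have e2 : ∀ j : ZMod q, indic (orientT a b c i j k = 0) = indic (w ⬝ᵥ edgeVec b j = t) := by
      intro j; rw [hO j, sub_eq_zero]
    simp only [e1, e2]
    omega
  unfold flipsB zeroCount
  conv_lhs => arg 2; ext i; rw [Finset.sum_comm]
  conv_rhs => arg 2; arg 2; arg 2; ext i; rw [Finset.sum_comm]
  calc ∑ i : ZMod q, ∑ k : ZMod q, ∑ j : ZMod q, indic (flipB a b c i j k)
      ≤ ∑ i : ZMod q, ∑ k : ZMod q, (K + 2 * ∑ j : ZMod q, indic (orientT a b c i j k = 0)) :=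
        Finset.sum_le_sum fun i _ => Finset.sum_le_sum fun k _ => inner i k
    _ = K * q ^ 2 + 2 * ∑ i : ZMod q, ∑ k : ZMod q, ∑ j : ZMod q, indic (orientT a b c i j k = 0) := by
        simp only [Finset.sum_add_distrib, sum_const_nat, ← Finset.mul_sum]
        ring

/-- **Crossing-number form of the totals law**: `T ≤ (K_a + K_b + K_c)·q² + 6Z` whenever the three hodographs have affine crossing
numbers `≤ K_a, K_b, K_c`. [folklore] -/
theorem totalVert_le_of_fewCrossings {Ka Kb Kc : ℕ} (ha : FewCrossings (edgeVec a) Ka) (hb : FewCrossings (edgeVec b) Kb)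
    (hc : FewCrossings (edgeVec c) Kc) : totalVert a b c ≤ (Ka + Kb + Kc) * q ^ 2 + 6 * zeroCount a b c := by
  have h := totalVert_le_flips a b c
  have hA := flipsA_le_of_fewCrossings a b c ha
  have hB := flipsB_le_of_fewCrossings a b c hb
  have hC := flipsC_le_of_fewCrossings a b c hc
  have e : (Ka + Kb + Kc) * q ^ 2 = Ka * q ^ 2 + Kb * q ^ 2 + Kc * q ^ 2 := by ring
  omega

end Crossings

end TotalsLaw

end Summit.ValiantsHypothesis.ValiantsHypothesis.Theorems.NewtonUnitEquationsDissociatedUniform
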